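import Mathlib
import HarnessLib
import Summits.Ventures.LatticeQCDFlow.Exactness.IMHMultiProposalMinorisation

/-!
# No free lunch in the batch size: from a configuration of weight `w(x)` the multi-proposal (ensemble) flow sampler STAYS with probability
# at least `w(x)/(w(x) + n)` per update — leaving a heavy configuration costs `≳ w(x)` flow proposals in total, batched or not

HONEST FRAMING: exact (Metropolis-corrected) sampling algorithms for lattice gauge theory;
figures of merit are autocorrelation/cost numbers at stated couplings and volumes; no
continuum-physics claim.

Venture `LatticeQCDFlow` (cell pub-lqcd), topic `Exactness`; FANOUT row 30 (lean-1, GEN-42).  NEW WORK of the cell, general measurable state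
space, over Mathlib and the tree's GEN-41 multi-proposal files (`IMHMultiProposalExact` for the pool-selection equation `hP`, def-free;
`IMHMultiProposalMinorisation` for Jensen's inequality for `s ↦ (c + s)⁻¹`).  GEN-41 proved the UPPER rate: with `m + 1` fresh proposals per
update and `w ≤ W`, `|μ₀Pᵗ(A) − π(A)| ≤ (1 − (m + 1)/(2W + m))ᵗ`.  This file is the matching FLOOR, and it needs no weight bound.

## Setting
`q` the flow's law, `w > 0` measurable with `∫ w dq = 1` (normalised weight, `π = w·q`), `n` fresh proposals per update, `P` any Markov kernel
satisfying the pool-selection equation `P(x, B) = ∫ [Σ_{j ≤ n} w(z_j)1_B(z_j)/Σ_{i ≤ n} w(z_i)]_{z = (x, y)} dq^{⊗n}(y)`.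

## Results (no `sorry`, no new definitions)
* §1 `inv_add_le_integral_inv_add_sum_of_integrable` — JENSEN `(c + n·∫w dq)⁻¹ ≤ E_{q^{⊗n}}[(c + Σ_i w(y_i))⁻¹]` for an INTEGRABLE weight (the
  GEN-41 lemma assumed `w ≤ W`); `lintegral_const_div_add_sum_ge` — its `ℝ≥0∞` form `ofReal(c/(c + n)) ≤ ∫ ofReal c/(ofReal c + Σ ofReal w(y_i))`.
* §2 `multiProposal_apply_self_ge_lintegral` — `P(x, {x}) ≥ E[w(x)/(w(x) + Σ_i w(y_i))]` (the current state's own pool term);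
  **`multiProposal_apply_self_ge`** — `P(x, {x}) ≥ w(x)/(w(x) + n)` FOR EVERY `x`: a batch of `n` proposals dislodges a configuration of weight
  `w(x)` with probability at most `n/(w(x) + n)`.
* §3 `iterate_bind_apply_self_ge` (any kernel: `(δ_x Pᵗ)({x}) ≥ ρᵗ` once `P(x, {x}) ≥ ρ`), **`multiProposal_sticking_floor`** —
  `(δ_x Pᵗ)({x}) ≥ (w(x)/(w(x) + n))ᵗ`; `one_sub_mul_div_le_pow` (Bernoulli: `1 − t·n/(w(x) + n) ≤ (w(x)/(w(x) + n))ᵗ`);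
  **`multiProposal_singleton_deviation_ge`** — for a target without an atom at `x`, `|δ_xPᵗ({x}) − π({x})| ≥ 1 − t·n/(w(x) + n)`: the law after
  `t` batch updates is at total-variation distance at least that from `π`; **`multiProposal_total_proposals_ge`** — if after `t` updates the chain
  has left `x` with probability at least `1/2`, then `t·n ≥ (w(x) + n)/2`: THE TOTAL NUMBER OF FLOW PROPOSALS SPENT IS AT LEAST HALF THE WEIGHT
  OF THE STARTING CONFIGURATION, however they are batched.
Reading (gauge files, with GEN-41's rate): from the heaviest configuration (`w = W`) the per-update renewal probability of the ensemble sampler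
lies between `n/(W + n)` (this file) and, for TV, the contraction `(n)/(2W + n − 1)` (GEN-41, `m + 1 = n`): batching `n ≈ W` proposals
parallelises the `≈ W` proposals an escape costs; it does not reduce them.  NOT CLAIMED: anything at equilibrium (separate file), lower bounds
for observables other than the indicator of the starting configuration.
-/

noncomputable section

namespace Summit.Ventures.LatticeQCDFlow.Exactness

open MeasureTheory ProbabilityTheory Function Finset
open scoped ENNReal

variable {Ω : Type*} [MeasurableSpace Ω] {q : Measure Ω} [IsProbabilityMeasure q] {w : Ω → ℝ} {n : ℕ}

/-! ## §1 Jensen for `(c + s)⁻¹` with an integrable weight -/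

/-- `∫ Σ_i w(b_i) dq^{⊗n} = n·∫ w dq` for an integrable weight. [ours, bookkeeping] -/
theorem integral_sum_weight_eq_of_integrable (hw : Measurable w) (hwi : Integrable w q) :
    ∫ b, ∑ i, w (b i) ∂(Measure.pi fun _ : Fin n => q) = n * ∫ y, w y ∂q := by
  rw [integral_finsetSum _ fun i _ => ?_]
  · simp_rw [integral_coord_weight_eq hw]
    rw [sum_const, card_univ, Fintype.card_fin, nsmul_eq_mul]
  · exact ((measurePreserving_eval (fun _ : Fin n => q) i).integrable_comp hw.aestronglyMeasurable).2 hwi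

/-- **JENSEN: `(c + n·∫w dq)⁻¹ ≤ E_{q^{⊗n}}[(c + Σ_i w(y_i))⁻¹]`** for `c > 0` and a nonnegative INTEGRABLE measurable weight. [ours] -/
theorem inv_add_le_integral_inv_add_sum_of_integrable (hw : Measurable w) (hw0 : ∀ y, 0 ≤ w y) (hwi : Integrable w q) {c : ℝ}
    (hc : 0 < c) : (c + n * ∫ y, w y ∂q)⁻¹ ≤ ∫ b, (c + ∑ i, w (b i))⁻¹ ∂(Measure.pi fun _ : Fin n => q) := by
  set μ : Measure (Fin n → Ω) := Measure.pi fun _ : Fin n => q with hμ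
  have hSm : Measurable fun b : Fin n → Ω => ∑ i, w (b i) := Finset.measurable_sum _ fun i _ => hw.comp (measurable_pi_apply i)
  have hS0 : ∀ b : Fin n → Ω, 0 ≤ ∑ i, w (b i) := fun b => sum_nonneg fun i _ => hw0 _
  have hSi : Integrable (fun b : Fin n → Ω => ∑ i, w (b i)) μ :=
    integrable_finsetSum _ fun i _ => ((measurePreserving_eval (fun _ : Fin n => q) i).integrable_comp hw.aestronglyMeasurable).2 hwi
  have hφi : Integrable ((fun s : ℝ => (c + s)⁻¹) ∘ fun b : Fin n → Ω => ∑ i, w (b i)) μ :=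
    Integrable.of_bound ((measurable_const.add hSm).inv.aestronglyMeasurable) c⁻¹ (ae_of_all _ fun b => by
      simp only [Function.comp, Real.norm_eq_abs]
      have hpos : 0 < c + ∑ i, w (b i) := add_pos_of_pos_of_nonneg hc (hS0 b)
      rw [abs_of_pos (inv_pos.2 hpos)]
      exact inv_anti₀ hc (le_add_of_nonneg_right (hS0 b)))
  have hcont : ContinuousOn (fun s : ℝ => (c + s)⁻¹) (Set.Ici 0) :=
    ContinuousOn.inv₀ (continuousOn_const.add continuousOn_id) fun s hs => ne_of_gt (add_pos_of_pos_of_nonneg hc hs)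
  have hJ := (convexOn_inv_const_add hc).map_integral_le hcont isClosed_Ici (ae_of_all _ fun b => hS0 b) hSi hφi
  rw [integral_sum_weight_eq_of_integrable hw hwi] at hJ
  exact hJ

/-- The `ℝ≥0∞` form with the numerator: **`ofReal (c/(c + n)) ≤ ∫ ofReal c/(ofReal c + Σ_i ofReal w(y_i)) dq^{⊗n}`** for a normalised
nonnegative weight and `c > 0`. [ours] -/
theorem lintegral_const_div_add_sum_ge (hw : Measurable w) (hw0 : ∀ y, 0 ≤ w y) (h1 : ∫ y, w y ∂q = 1) {c : ℝ} (hc : 0 < c) :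
    ENNReal.ofReal (c / (c + n)) ≤
      ∫⁻ b, ENNReal.ofReal c / (ENNReal.ofReal c + ∑ i, ENNReal.ofReal (w (b i))) ∂(Measure.pi fun _ : Fin n => q) := by
  set μ : Measure (Fin n → Ω) := Measure.pi fun _ : Fin n => q with hμ
  have hwi : Integrable w q := by
    by_contra h
    rw [integral_undef h] at h1
    exact zero_ne_one h1
  have hS0 : ∀ b : Fin n → Ω, 0 ≤ ∑ i, w (b i) := fun b => sum_nonneg fun i _ => hw0 _
  have hSm : Measurable fun b : Fin n → Ω => ∑ i, w (b i) := Finset.measurable_sum _ fun i _ => hw.comp (measurable_pi_apply i)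
  have hpt : ∀ b : Fin n → Ω, ENNReal.ofReal c / (ENNReal.ofReal c + ∑ i, ENNReal.ofReal (w (b i))) =
      ENNReal.ofReal (c * (c + ∑ i, w (b i))⁻¹) := by
    intro b
    have hpos : 0 < c + ∑ i, w (b i) := add_pos_of_pos_of_nonneg hc (hS0 b)
    rw [← ENNReal.ofReal_sum_of_nonneg (fun i _ => hw0 _), ← ENNReal.ofReal_add hc.le (hS0 b), div_eq_mul_inv,
      ← ENNReal.ofReal_inv_of_pos hpos, ← ENNReal.ofReal_mul hc.le]
  simp_rw [hpt]
  have hgi0 : Integrable (fun b : Fin n → Ω => (c + ∑ i, w (b i))⁻¹) μ :=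
    Integrable.of_bound ((measurable_const.add hSm).inv.aestronglyMeasurable) c⁻¹ (ae_of_all _ fun b => by
      rw [Real.norm_eq_abs]
      have hpos : 0 < c + ∑ i, w (b i) := add_pos_of_pos_of_nonneg hc (hS0 b)
      rw [abs_of_pos (inv_pos.2 hpos)]
      exact inv_anti₀ hc (le_add_of_nonneg_right (hS0 b)))
  have hgi : Integrable (fun b : Fin n → Ω => c * (c + ∑ i, w (b i))⁻¹) μ := hgi0.const_mul c
  rw [← ofReal_integral_eq_lintegral_ofReal hgi (ae_of_all _ fun b =>
    mul_nonneg hc.le (inv_nonneg.2 (add_pos_of_pos_of_nonneg hc (hS0 b)).le))]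
  refine ENNReal.ofReal_le_ofReal ?_
  rw [integral_const_mul, div_eq_mul_inv]
  refine mul_le_mul_of_nonneg_left ?_ hc.le
  have h := inv_add_le_integral_inv_add_sum_of_integrable (q := q) (n := n) hw hw0 hwi hc
  rwa [h1, mul_one] at h

/-! ## §2 The holding floor from every state -/

omit [IsProbabilityMeasure q] in
/-- **`P(x, {x}) ≥ E_{q^{⊗n}}[w(x)/(w(x) + Σ_i w(y_i))]`**: the pool always contains the current configuration, whose selection term alone
gives this much holding. [ours] -/
theorem multiProposal_apply_self_ge_lintegral (hw0 : ∀ y, 0 < w y) (P : Kernel Ω Ω)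
    (hP : ∀ (x : Ω) {B : Set Ω}, MeasurableSet B → P x B = ∫⁻ y, (∑ j, ENNReal.ofReal (w (Fin.cons (α := fun _ : Fin (n + 1) => Ω) x y j)) *
      B.indicator (fun _ => (1 : ℝ≥0∞)) (Fin.cons (α := fun _ : Fin (n + 1) => Ω) x y j)) /
      (∑ i, ENNReal.ofReal (w (Fin.cons (α := fun _ : Fin (n + 1) => Ω) x y i))) ∂(Measure.pi fun _ : Fin n => q))
    (x : Ω) (hx : MeasurableSet ({x} : Set Ω)) :
    ∫⁻ y, ENNReal.ofReal (w x) / (ENNReal.ofReal (w x) + ∑ i, ENNReal.ofReal (w (y i))) ∂(Measure.pi fun _ : Fin n => q) ≤ P x {x} := by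
  rw [hP x hx]
  refine lintegral_mono fun y => ?_
  have hden : ∑ i, ENNReal.ofReal (w (Fin.cons (α := fun _ : Fin (n + 1) => Ω) x y i)) =
      ENNReal.ofReal (w x) + ∑ i, ENNReal.ofReal (w (y i)) := by
    rw [Fin.sum_univ_succ]; simp only [Fin.cons_zero, Fin.cons_succ]
  have hnum : ENNReal.ofReal (w x) ≤ ∑ j, ENNReal.ofReal (w (Fin.cons (α := fun _ : Fin (n + 1) => Ω) x y j)) *
      ({x} : Set Ω).indicator (fun _ => (1 : ℝ≥0∞)) (Fin.cons (α := fun _ : Fin (n + 1) => Ω) x y j) := by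
    rw [Fin.sum_univ_succ]
    simp only [Fin.cons_zero, Fin.cons_succ, Set.indicator_of_mem (Set.mem_singleton x), mul_one]
    exact le_self_add
  have _ := hw0 x
  rw [hden]
  exact ENNReal.div_le_div_right hnum _

/-- **THE HOLDING FLOOR: `P(x, {x}) ≥ w(x)/(w(x) + n)` FROM EVERY CONFIGURATION `x`** — for the pool-selection sampler with `n` fresh flow
proposals per update and a normalised positive weight.  A batch of `n` proposals dislodges a configuration of weight `w(x)` with probability at
most `n/(w(x) + n)`. [ours] -/
theorem multiProposal_apply_self_ge (hw : Measurable w) (hw0 : ∀ y, 0 < w y) (h1 : ∫ y, w y ∂q = 1) (P : Kernel Ω Ω)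
    (hP : ∀ (x : Ω) {B : Set Ω}, MeasurableSet B → P x B = ∫⁻ y, (∑ j, ENNReal.ofReal (w (Fin.cons (α := fun _ : Fin (n + 1) => Ω) x y j)) *
      B.indicator (fun _ => (1 : ℝ≥0∞)) (Fin.cons (α := fun _ : Fin (n + 1) => Ω) x y j)) /
      (∑ i, ENNReal.ofReal (w (Fin.cons (α := fun _ : Fin (n + 1) => Ω) x y i))) ∂(Measure.pi fun _ : Fin n => q))
    (x : Ω) (hx : MeasurableSet ({x} : Set Ω)) :
    ENNReal.ofReal (w x / (w x + n)) ≤ P x {x} :=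
  (lintegral_const_div_add_sum_ge hw (fun y => (hw0 y).le) h1 (hw0 x)).trans (multiProposal_apply_self_ge_lintegral hw0 P hP x hx)

/-! ## §3 Sticking over `t` updates, the total-variation floor and the total-proposal count -/

/-- **Any kernel: a holding floor iterates.**  If `P(x, {x}) ≥ ρ` then `(δ_x Pᵗ)({x}) ≥ ρᵗ` for every `t`. [ours] -/
theorem iterate_bind_apply_self_ge [MeasurableSingletonClass Ω] (P : Kernel Ω Ω) {x : Ω} {ρ : ℝ≥0∞} (hρ : ρ ≤ P x {x}) (t : ℕ) :
    ρ ^ t ≤ ((fun μ : Measure Ω => μ.bind P)^[t] (Measure.dirac x)) {x} := by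
  induction t with
  | zero => simp
  | succ t ih =>
    set μ := (fun μ : Measure Ω => μ.bind P)^[t] (Measure.dirac x) with hμ
    rw [Function.iterate_succ_apply', ← hμ, Measure.bind_apply (measurableSet_singleton x) (Kernel.aemeasurable _)]
    calc ρ ^ (t + 1) = ρ * ρ ^ t := pow_succ' ρ t
      _ ≤ P x {x} * μ {x} := mul_le_mul' hρ ih
      _ = ∫⁻ z in {x}, P z {x} ∂μ := (lintegral_singleton (μ := μ) (fun z => P z {x}) x).symm
      _ ≤ ∫⁻ z, P z {x} ∂μ := setLIntegral_le_lintegral _ _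

/-- **THE STICKING FLOOR over `t` batch updates: `(δ_x Pᵗ)({x}) ≥ (w(x)/(w(x) + n))ᵗ`.** [ours] -/
theorem multiProposal_sticking_floor [MeasurableSingletonClass Ω] (hw : Measurable w) (hw0 : ∀ y, 0 < w y) (h1 : ∫ y, w y ∂q = 1)
    (P : Kernel Ω Ω)
    (hP : ∀ (x : Ω) {B : Set Ω}, MeasurableSet B → P x B = ∫⁻ y, (∑ j, ENNReal.ofReal (w (Fin.cons (α := fun _ : Fin (n + 1) => Ω) x y j)) *
      B.indicator (fun _ => (1 : ℝ≥0∞)) (Fin.cons (α := fun _ : Fin (n + 1) => Ω) x y j)) /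
      (∑ i, ENNReal.ofReal (w (Fin.cons (α := fun _ : Fin (n + 1) => Ω) x y i))) ∂(Measure.pi fun _ : Fin n => q))
    (x : Ω) (t : ℕ) :
    ENNReal.ofReal ((w x / (w x + n)) ^ t) ≤ ((fun μ : Measure Ω => μ.bind P)^[t] (Measure.dirac x)) {x} := by
  rw [ENNReal.ofReal_pow (div_nonneg (hw0 x).le (add_pos_of_pos_of_nonneg (hw0 x) n.cast_nonneg).le)]
  exact iterate_bind_apply_self_ge P (multiProposal_apply_self_ge hw hw0 h1 P hP x (measurableSet_singleton x)) t

omit [MeasurableSpace Ω] in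
/-- Bernoulli: `1 − t·(n/(w(x) + n)) ≤ (w(x)/(w(x) + n))ᵗ`. [folklore] -/
theorem one_sub_mul_div_le_pow {x : Ω} (hw0x : 0 < w x) (t n : ℕ) :
    1 - t * (n / (w x + n)) ≤ (w x / (w x + n)) ^ t := by
  have hpos : 0 < w x + n := add_pos_of_pos_of_nonneg hw0x n.cast_nonneg
  have heq : w x / (w x + n) = 1 + (-(n / (w x + n))) := by
    field_simp; ring
  have hge : (-2 : ℝ) ≤ -(n / (w x + n)) := by
    have : n / (w x + n) ≤ 1 := by rw [div_le_one hpos]; linarith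
    linarith
  have h := one_add_mul_le_pow hge t
  rw [heq]
  linarith

/-- **THE TOTAL-VARIATION FLOOR**: if the target has no atom at `x` (`π({x}) = 0`), then after `t` batch updates of size `n` from `x`
`|δ_xPᵗ({x}) − π({x})| ≥ 1 − t·n/(w(x) + n)` — so the total-variation distance to `π` is at least that. [ours] -/
theorem multiProposal_singleton_deviation_ge [MeasurableSingletonClass Ω] (hw : Measurable w) (hw0 : ∀ y, 0 < w y) (h1 : ∫ y, w y ∂q = 1)
    (P : Kernel Ω Ω) [IsMarkovKernel P]
    (hP : ∀ (x : Ω) {B : Set Ω}, MeasurableSet B → P x B = ∫⁻ y, (∑ j, ENNReal.ofReal (w (Fin.cons (α := fun _ : Fin (n + 1) => Ω) x y j)) *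
      B.indicator (fun _ => (1 : ℝ≥0∞)) (Fin.cons (α := fun _ : Fin (n + 1) => Ω) x y j)) /
      (∑ i, ENNReal.ofReal (w (Fin.cons (α := fun _ : Fin (n + 1) => Ω) x y i))) ∂(Measure.pi fun _ : Fin n => q))
    (x : Ω) (hπx : (q.withDensity fun y => ENNReal.ofReal (w y)) {x} = 0) (t : ℕ) :
    1 - t * (n / (w x + n)) ≤
      |(((fun μ : Measure Ω => μ.bind P)^[t] (Measure.dirac x)) {x}).toReal - ((q.withDensity fun y => ENNReal.ofReal (w y)) {x}).toReal| := by
  set μ := (fun μ : Measure Ω => μ.bind P)^[t] (Measure.dirac x) with hμ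
  haveI : IsProbabilityMeasure μ := by
    rw [hμ]
    clear hμ μ
    induction t with
    | zero => simpa using (inferInstance : IsProbabilityMeasure (Measure.dirac x))
    | succ t ih =>
      rw [Function.iterate_succ_apply']
      haveI := ih
      exact ⟨by rw [Measure.bind_apply MeasurableSet.univ (Kernel.aemeasurable _)]; simp⟩
  rw [hπx, ENNReal.toReal_zero, sub_zero, abs_of_nonneg ENNReal.toReal_nonneg]
  calc 1 - t * (n / (w x + n)) ≤ (w x / (w x + n)) ^ t := one_sub_mul_div_le_pow (hw0 x) t n
    _ = (ENNReal.ofReal ((w x / (w x + n)) ^ t)).toReal :=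
        (ENNReal.toReal_ofReal (pow_nonneg (div_nonneg (hw0 x).le (add_pos_of_pos_of_nonneg (hw0 x) n.cast_nonneg).le) t)).symm
    _ ≤ (μ {x}).toReal := ENNReal.toReal_mono (measure_ne_top μ _) (multiProposal_sticking_floor hw hw0 h1 P hP x t)

/-- **THE TOTAL-PROPOSAL COUNT**: if after `t` batch updates of size `n` the chain started at `x` has left `x` with probability at least
`1/2` (necessary for being within total variation `1/2` of an atomless target), then `t·n ≥ (w(x) + n)/2` — in particular at least `w(x)/2`
flow proposals have been spent, however they were batched. [ours] -/
theorem multiProposal_total_proposals_ge [MeasurableSingletonClass Ω] (hw : Measurable w) (hw0 : ∀ y, 0 < w y) (h1 : ∫ y, w y ∂q = 1)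
    (P : Kernel Ω Ω) [IsMarkovKernel P]
    (hP : ∀ (x : Ω) {B : Set Ω}, MeasurableSet B → P x B = ∫⁻ y, (∑ j, ENNReal.ofReal (w (Fin.cons (α := fun _ : Fin (n + 1) => Ω) x y j)) *
      B.indicator (fun _ => (1 : ℝ≥0∞)) (Fin.cons (α := fun _ : Fin (n + 1) => Ω) x y j)) /
      (∑ i, ENNReal.ofReal (w (Fin.cons (α := fun _ : Fin (n + 1) => Ω) x y i))) ∂(Measure.pi fun _ : Fin n => q))
    (x : Ω) (t : ℕ) (ht : (((fun μ : Measure Ω => μ.bind P)^[t] (Measure.dirac x)) {x}).toReal ≤ 1 / 2) :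
    (w x + n) / 2 ≤ t * n := by
  set μ := (fun μ : Measure Ω => μ.bind P)^[t] (Measure.dirac x) with hμ
  haveI : IsProbabilityMeasure μ := by
    rw [hμ]
    clear hμ μ ht
    induction t with
    | zero => simpa using (inferInstance : IsProbabilityMeasure (Measure.dirac x))
    | succ t ih =>
      rw [Function.iterate_succ_apply']
      haveI := ih
      exact ⟨by rw [Measure.bind_apply MeasurableSet.univ (Kernel.aemeasurable _)]; simp⟩
  have hpos : 0 < w x + n := add_pos_of_pos_of_nonneg (hw0 x) n.cast_nonneg
  have hfloor : 1 - t * (n / (w x + n)) ≤ (μ {x}).toReal :=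
    calc 1 - t * (n / (w x + n)) ≤ (w x / (w x + n)) ^ t := one_sub_mul_div_le_pow (hw0 x) t n
      _ = (ENNReal.ofReal ((w x / (w x + n)) ^ t)).toReal :=
          (ENNReal.toReal_ofReal (pow_nonneg (div_nonneg (hw0 x).le hpos.le) t)).symm
      _ ≤ (μ {x}).toReal := ENNReal.toReal_mono (measure_ne_top μ _) (multiProposal_sticking_floor hw hw0 h1 P hP x t)
  have h : 1 / 2 ≤ t * (n / (w x + n)) := by linarith
  rw [mul_div_assoc'] at h
  have h2 : 1 / 2 * (w x + n) ≤ t * n := (le_div_iff₀ hpos).1 h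
  linarith

end Summit.Ventures.LatticeQCDFlow.Exactness
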